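import Summits.CriticalPhenomena.PercolationContinuityZ3.Theorems.PercNearOneGluingNoHeavyLowerTailSahiIndependentProducts
import Summits.CriticalPhenomena.PercolationContinuityZ3.Theorems.PercNearOneGluingNoHeavyLowerTailSahiTwoChainUnions
import Literature.Combinatorics.Sahi2008.TotalOrder
import HarnessLib

/-!
# Sahi positivity of every order is preserved by TENSORING WITH A CHAIN OF EVENTS on an independent factor —
# in particular by AND-ing one common independent coin onto any sub-family ("push-down")

Support file for the Sahi / hitting-event programme (seat `prim-l12-p5`, gen 14; `--supports stmt-CriticalPhenomena-4575`).
No definitions, no named facts, no sorries; standard axioms.  Memo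
`run/shared/lean/prim/prim-l12/FROM-prim-l12-p5-g14-PUSHUP-LEMMA.md` §2.

**THEOREM (`sahiE_chainInd_mul_nonneg`).**  Let `P` be a probability weight on a finite type `Ω`,
`f_0,…,f_{n-1} : Ω → ℝ` a family that is Sahi-nonnegative at EVERY order with multiplicities
(`E_m(f_{ι 0},…,f_{ι (m-1)}) ≥ 0` for all `m` and all index maps `ι`), and `G_0,…,G_{n-1} ⊆ Ω` events that are pairwise
`⊆`-COMPARABLE and whose block indicators are uncorrelated with the block products of `f`
(`E[∏_{i∈S} 1_{G_i} · ∏_{i∈S} f_i] = E[∏_{i∈S} 1_{G_i}] E[∏_{i∈S} f_i]`, e.g. `f` and `G` read disjoint coordinates of a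
product space).  Then `E_n(1_{G_0} f_0, …, 1_{G_{n-1}} f_{n-1}) ≥ 0`.

Product-space form (`sahiE_prodWeight_chainInd_mul_nonneg`): `φ_i` on `(α, μ)` hereditarily Sahi-nonnegative, `H_i` a `⊆`-chain of
events of `(β, ν)`; then `E_n^{μ⊗ν}(φ_0 ⊗ 1_{H_0}, …) ≥ 0`.  The case "`H_i = C` for `i ∈ T`, `H_i = univ` otherwise"
(`sahiE_prodWeight_mul_commonEvent_nonneg`) says: **AND-ing ONE common independent event onto an arbitrary sub-family of a
hereditarily Sahi-nonnegative family keeps it Sahi-nonnegative at every order** (the "push-down" of the memo: in pattern-law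
language `π ↦ λπ + (1−λ)(del_T)_*π`; iterated from the sure family this is Sahi's Theorem 2 for cylinder events).  The dual
"push-up" (OR-ing a common fresh coin) is the memo's FRESH-COIN LEMMA, which would give Sahi positivity of ALL hitting families
at every order; it is NOT proved here.

PROOF.  The block products `∏_{i∈B} 1_{G_i}` of a `⊆`-chain are indicators of members of the chain (or of `univ`)
(`exists_prod_indicator_chain`), so every family of block products is a family of indicators of pairwise comparable events,
Sahi-nonnegative at every order under every probability weight [Blinovsky 2013, Lemma 1; tree
`Literature.Combinatorics.Sahi2008.sahiE_indicator_nonneg_of_total`]; the tree's independent product theorem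
`SahiIndependentProducts.sahiE_mul_nonneg_of_indepMoments` [Sahi2008, Prop. 12] concludes. [this work]
-/

namespace Summit.CriticalPhenomena.PercolationContinuityZ3.Theorems

namespace SahiChainTensor

open Finset Literature.Combinatorics.Sahi2008

variable {Ω : Type*} [Fintype Ω]

omit [Fintype Ω] in
/-- The product over a finset `B` of the indicators of a `⊆`-chain of sets is the indicator of `univ` (if `B = ∅`) or of
one of the sets `G_i`, `i ∈ B` (the smallest one). [folklore] -/
theorem exists_prod_indicator_chain {n : ℕ} (G : Fin n → Set Ω) (hG : ∀ i j, G i ⊆ G j ∨ G j ⊆ G i)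
    (B : Finset (Fin n)) :
    ∃ X : Set Ω, (X = Set.univ ∨ ∃ i ∈ B, X = G i) ∧
      (∏ i ∈ B, (G i).indicator (1 : Ω → ℝ)) = X.indicator 1 := by
  classical
  induction B using Finset.induction_on with
  | empty => exact ⟨Set.univ, Or.inl rfl, by simp⟩
  | insert a s ha ih =>
    obtain ⟨X, hX, hprod⟩ := ih
    rw [Finset.prod_insert ha, hprod, ← Set.inter_indicator_one]
    rcases hX with rfl | ⟨i, hi, rfl⟩
    · exact ⟨G a, Or.inr ⟨a, mem_insert_self a s, rfl⟩, by rw [Set.inter_univ]⟩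
    · rcases hG a i with h | h
      · exact ⟨G a, Or.inr ⟨a, mem_insert_self a s, rfl⟩, by rw [Set.inter_eq_left.mpr h]⟩
      · exact ⟨G i, Or.inr ⟨i, mem_insert_of_mem hi, rfl⟩, by rw [Set.inter_eq_right.mpr h]⟩

/-- Every family of block products of the indicators of a `⊆`-chain is Sahi-nonnegative at every order, under every
probability weight. [cite: Blinovsky2013FormalSeries, Lemma 1] -/
theorem sahiE_prod_indicator_chain_nonneg (P : Ω → ℝ) (hP₀ : ∀ ω, 0 ≤ P ω) (hP₁ : ∑ ω, P ω = 1) {n : ℕ}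
    (G : Fin n → Set Ω) (hG : ∀ i j, G i ⊆ G j ∨ G j ⊆ G i) (m : ℕ) (B : Fin m → Finset (Fin n)) :
    0 ≤ sahiE P m (fun j => ∏ i ∈ B j, (G i).indicator (1 : Ω → ℝ)) := by
  choose X hX hprod using fun j => exists_prod_indicator_chain G hG (B j)
  have h : (fun j => ∏ i ∈ B j, (G i).indicator (1 : Ω → ℝ)) = fun j => (X j).indicator 1 := funext hprod
  rw [h]
  refine sahiE_indicator_nonneg_of_total hP₀ hP₁ X fun j k => ?_
  rcases hX j with hj | ⟨i, -, hj⟩ <;> rcases hX k with hk | ⟨i', -, hk⟩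
  · exact Or.inl (by rw [hj, hk])
  · exact Or.inr (by rw [hj]; exact Set.subset_univ _)
  · exact Or.inl (by rw [hk]; exact Set.subset_univ _)
  · rw [hj, hk]; exact hG i i'

/-- **Tensoring with a chain of events preserves Sahi positivity of every order** (single-space form).  `P` a probability
weight, `f` Sahi-nonnegative at every order with multiplicities, `G` pairwise `⊆`-comparable events whose block indicators
are uncorrelated with the block products of `f`; then `E_n(1_{G_0} f_0,…,1_{G_{n-1}} f_{n-1}) ≥ 0`. [this work] -/
theorem sahiE_chainInd_mul_nonneg (P : Ω → ℝ) (hP₀ : ∀ ω, 0 ≤ P ω) (hP₁ : ∑ ω, P ω = 1) {n : ℕ}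
    (G : Fin n → Set Ω) (hG : ∀ i j, G i ⊆ G j ∨ G j ⊆ G i) (f : Fin n → Ω → ℝ)
    (hind : ∀ S : Finset (Fin n),
      ex P ((∏ i ∈ S, (G i).indicator (1 : Ω → ℝ)) * ∏ i ∈ S, f i) =
        ex P (∏ i ∈ S, (G i).indicator (1 : Ω → ℝ)) * ex P (∏ i ∈ S, f i))
    (hf : ∀ (m : ℕ) (ι : Fin m → Fin n), 0 ≤ sahiE P m (fun j => f (ι j))) :
    0 ≤ sahiE P n (fun i => (G i).indicator (1 : Ω → ℝ) * f i) :=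
  SahiIndependentProducts.sahiE_mul_nonneg_of_indepMoments P hP₁ (fun i => (G i).indicator 1) f hind hf
    (sahiE_prod_indicator_chain_nonneg P hP₀ hP₁ G hG)

/-! ### Product-space form -/

variable {α β : Type*} [Fintype α] [Fintype β]

/-- The product weight of two probability weights, as a function on `α × β` (local notation-free helper statement):
its total mass is `1`. [folklore] -/
theorem sum_prodWeight_eq_one (μ : α → ℝ) (ν : β → ℝ) (hμ₁ : ∑ x, μ x = 1) (hν₁ : ∑ y, ν y = 1) :
    ∑ p : α × β, μ p.1 * ν p.2 = 1 := by
  rw [Fintype.sum_prod_type, ← Finset.sum_mul_sum, hμ₁, hν₁, one_mul]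

omit [Fintype α] [Fintype β] in
/-- Block products of functions lifted from the two factors split as a tensor (plumbing). [folklore] -/
theorem prod_lift_mul_prod_lift {n : ℕ} (S : Finset (Fin n)) (g : Fin n → β → ℝ) (φ : Fin n → α → ℝ) :
    ((∏ i ∈ S, fun p : α × β => g i p.2) * ∏ i ∈ S, fun p : α × β => φ i p.1) =
      fun p : α × β => (∏ i ∈ S, φ i) p.1 * (∏ i ∈ S, g i) p.2 := by
  funext p
  simp only [Pi.mul_apply, Finset.prod_apply]
  ring

/-- **Tensoring with a chain of events preserves Sahi positivity of every order** (product form).  `μ`, `ν` probability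
weights on finite `α`, `β`; `φ_i : α → ℝ` hereditarily Sahi-nonnegative (every order, with multiplicities); `H_i ⊆ β`
pairwise `⊆`-comparable events.  Then under `μ ⊗ ν`, `E_n(φ_0 ⊗ 1_{H_0}, …, φ_{n-1} ⊗ 1_{H_{n-1}}) ≥ 0`. [this work] -/
theorem sahiE_prodWeight_chainInd_mul_nonneg (μ : α → ℝ) (ν : β → ℝ) (hμ₀ : ∀ x, 0 ≤ μ x) (hμ₁ : ∑ x, μ x = 1)
    (hν₀ : ∀ y, 0 ≤ ν y) (hν₁ : ∑ y, ν y = 1) {n : ℕ} (φ : Fin n → α → ℝ)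
    (hφ : ∀ (m : ℕ) (ι : Fin m → Fin n), 0 ≤ sahiE μ m (fun j => φ (ι j)))
    (H : Fin n → Set β) (hH : ∀ i j, H i ⊆ H j ∨ H j ⊆ H i) :
    0 ≤ sahiE (fun p : α × β => μ p.1 * ν p.2) n
      (fun i p => (H i).indicator (1 : β → ℝ) p.2 * φ i p.1) := by
  set P : α × β → ℝ := fun p => μ p.1 * ν p.2 with hPdef
  have hP₀ : ∀ p, 0 ≤ P p := fun p => mul_nonneg (hμ₀ _) (hν₀ _)
  have hP₁ : ∑ p, P p = 1 := sum_prodWeight_eq_one μ ν hμ₁ hν₁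
  -- the lifted events `G i = {p | p.2 ∈ H i}` form a chain
  set G : Fin n → Set (α × β) := fun i => {p | p.2 ∈ H i} with hGdef
  have hG : ∀ i j, G i ⊆ G j ∨ G j ⊆ G i := by
    intro i j
    rcases hH i j with h | h
    · exact Or.inl fun p hp => h hp
    · exact Or.inr fun p hp => h hp
  have hGind : ∀ i, (G i).indicator (1 : α × β → ℝ) = fun p => (H i).indicator (1 : β → ℝ) p.2 := by
    intro i; funext p
    by_cases hp : p.2 ∈ H i
    · rw [Set.indicator_of_mem hp, Set.indicator_of_mem (show p ∈ G i from hp)]; rfl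
    · rw [Set.indicator_of_notMem hp, Set.indicator_of_notMem (show p ∉ G i from hp)]
  have hfam : (fun i p => (H i).indicator (1 : β → ℝ) p.2 * φ i p.1) =
      fun i => (G i).indicator (1 : α × β → ℝ) * fun p => φ i p.1 := by
    funext i p; rw [hGind i]; rfl
  rw [hfam]
  refine sahiE_chainInd_mul_nonneg P hP₀ hP₁ G hG (fun i p => φ i p.1) (fun S => ?_) (fun m ι => ?_)
  · -- independence of the two factors
    have h1 : (∏ i ∈ S, (G i).indicator (1 : α × β → ℝ)) = ∏ i ∈ S, fun p : α × β => (H i).indicator (1 : β → ℝ) p.2 :=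
      Finset.prod_congr rfl fun i _ => hGind i
    rw [h1, prod_lift_mul_prod_lift S (fun i => (H i).indicator (1 : β → ℝ)) φ, hPdef,
      TwoChainUnions.ex_prodWeight_mul μ ν]
    have h2 : (∏ i ∈ S, fun p : α × β => (H i).indicator (1 : β → ℝ) p.2) =
        fun p : α × β => (1 : α → ℝ) p.1 * (∏ i ∈ S, (H i).indicator (1 : β → ℝ)) p.2 := by
      funext p; simp only [Finset.prod_apply, Pi.one_apply, one_mul]
    have h3 : (∏ i ∈ S, fun p : α × β => φ i p.1) =
        fun p : α × β => (∏ i ∈ S, φ i) p.1 * (1 : β → ℝ) p.2 := by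
      funext p; simp only [Finset.prod_apply, Pi.one_apply, mul_one]
    rw [h2, h3, TwoChainUnions.ex_prodWeight_mul μ ν, TwoChainUnions.ex_prodWeight_mul μ ν]
    have e1 : ex μ (1 : α → ℝ) = 1 := by rw [ex_def]; simp only [Pi.one_apply, mul_one]; exact hμ₁
    have e2 : ex ν (1 : β → ℝ) = 1 := by rw [ex_def]; simp only [Pi.one_apply, mul_one]; exact hν₁
    rw [e1, e2]; ring
  · -- the lifted family has the moments of `φ ∘ ι` under `μ`
    rw [TwoChainUnions.sahiE_congr_of_prodMoments P μ m (fun j p => φ (ι j) p.1) (fun j => φ (ι j)) fun S => ?_]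
    · exact hφ m ι
    · have h3 : (∏ j ∈ S, fun p : α × β => φ (ι j) p.1) =
          fun p : α × β => (∏ j ∈ S, φ (ι j)) p.1 * (1 : β → ℝ) p.2 := by
        funext p; simp only [Finset.prod_apply, Pi.one_apply, mul_one]
      have e2 : ex ν (1 : β → ℝ) = 1 := by rw [ex_def]; simp only [Pi.one_apply, mul_one]; exact hν₁
      rw [h3, hPdef, TwoChainUnions.ex_prodWeight_mul μ ν, e2, mul_one]

/-- **AND-ing one common independent event onto any sub-family preserves Sahi positivity of every order
("push-down").**  `φ_i` on `(α, μ)` hereditarily Sahi-nonnegative, `C ⊆ β` any event of an independent factor `(β, ν)`,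
`T` any set of slots: the family `φ_i ⊗ 1_C` (`i ∈ T`), `φ_i ⊗ 1` (`i ∉ T`) has `E_n ≥ 0` under `μ ⊗ ν`.
Iterated from the constant family this is Sahi's Theorem 2 for cylinder events; the general statement is the memo's
pattern-law "push-down" `π ↦ λπ + (1−λ)(del_T)_*π`. [this work] -/
theorem sahiE_prodWeight_mul_commonEvent_nonneg (μ : α → ℝ) (ν : β → ℝ) (hμ₀ : ∀ x, 0 ≤ μ x) (hμ₁ : ∑ x, μ x = 1)
    (hν₀ : ∀ y, 0 ≤ ν y) (hν₁ : ∑ y, ν y = 1) {n : ℕ} (φ : Fin n → α → ℝ)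
    (hφ : ∀ (m : ℕ) (ι : Fin m → Fin n), 0 ≤ sahiE μ m (fun j => φ (ι j)))
    (C : Set β) (T : Set (Fin n)) [DecidablePred (· ∈ T)] :
    0 ≤ sahiE (fun p : α × β => μ p.1 * ν p.2) n
      (fun i p => (if i ∈ T then C else Set.univ).indicator (1 : β → ℝ) p.2 * φ i p.1) := by
  refine sahiE_prodWeight_chainInd_mul_nonneg μ ν hμ₀ hμ₁ hν₀ hν₁ φ hφ (fun i => if i ∈ T then C else Set.univ)
    fun i j => ?_
  by_cases hi : i ∈ T <;> by_cases hj : j ∈ T <;> simp [hi, hj]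

end SahiChainTensor

end Summit.CriticalPhenomena.PercolationContinuityZ3.Theorems
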